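import Summits.CriticalPhenomena.PercolationContinuityZ3.Theses.PercNearOneGluing
import Summits.CriticalPhenomena.PercolationContinuityZ3.Theorems.PercNearOneGluingAdditiveGluingKnLemma3ii
import Summits.CriticalPhenomena.PercolationContinuityZ3.Theorems.PercNearOneGluingAdditiveGluingGluePushforward
import Literature.Probability.Percolation.PercolationEvents
import HarnessLib.Audit

/-! TTRL-lite variant V2397 of stmt-CriticalPhenomena-4574

Variant V2397 (`stub_shorteningStep` of line `kn_shortening_induction` with `n := 8`) is Kozma–Nitzan's
Conjecture 6 (arXiv:2401.12397 §5.3 p. 34, an open printed conjecture) on at most eight vertices and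
stays OPEN (verdict delivered as `open`; residual = the case `x ∉ A`).  This file lands the part of the
attempt that closed: **the case `x ∈ A` of `stub_shorteningStep`, for every `n`**, with no induction
hypothesis and no use of `w s(v,x) = 0`:

`x ∈ A`, `v ≠ x`, `P_w(a₀ ↔ b) ≤ P_w(a ↔ b)` for `a ∈ A` ⟹
`μ'(v ↔ A) · μ'(a₀ ↔ b) ≤ μ'(v ↔ b)` for `μ' = prodBernoulli (w[s(v,x) ↦ 1])`.

## Proof

Since `μ'(v ↔ A) ≤ 1` it suffices to show `μ'(a₀ ↔ b) ≤ μ'(v ↔ b)`.  Gluing is a push-forward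
(`stub_gluePushforward` with block `{v, x}`): `μ'(E) = μ_w{ω | ω ∪ {s(v,x)} ∈ E}`.  Write
`Φ ω = ω ∪ {s(v,x)}`.  A path lemma (`shorteningInA_reach_of_union`: an open path of `Φ ω` from a
vertex whose `ω`-cluster avoids `v` and `x` is an open path of `ω`) gives the two inclusions
`Φ⁻¹{a₀ ↔ b} ∖ Φ⁻¹{v ↔ b} ⊆ ({a₀ ↔ b} ∩ {a₀ ↮ v}) ∖ ({x ↔ b} ∩ {a₀ ↮ v})` and
`({x ↔ b} ∩ {a₀ ↮ v}) ∖ ({a₀ ↔ b} ∩ {a₀ ↮ v}) ⊆ Φ⁻¹{v ↔ b} ∖ Φ⁻¹{a₀ ↔ b}`, and KN Lemma 3(ii)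
(`stub_knLemma3ii`, the BHK conditional-association inequality, with the decreasing
`C_{a₀}`-determined event `Q = {a₀ ↮ v}` and `d = 0`) turns the minimiser hypothesis
`μ_w(a₀ ↔ b) ≤ μ_w(x ↔ b)` into `μ_w({a₀ ↔ b} ∩ Q) ≤ μ_w({x ↔ b} ∩ Q)`.  The elementary
`μ S ≤ μ T ⇒ μ(S ∖ T) ≤ μ(T ∖ S)` (twice) concludes.  In the family "`v` pendant to `a₀`" the
inequality is equivalent to the minimiser hypothesis, so Lemma 3(ii) is used sharply.
[cite: KozmaNitzan2024, Conjecture 6 and Lemma 3(ii)]  No new definitions, no named facts.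
-/

namespace Summit.CriticalPhenomena.PercolationContinuityZ3.Theorems

open MeasureTheory Set Literature.Probability.LatticeModels Literature.Probability.Percolation
open scoped Classical BigOperators

/-- Path lemma for one glued pair: if every pair of `D` is `s(v, x)` and the `ω`-cluster of `a`
contains neither `v` nor `x`, then every vertex reachable from `a` in the open graph of `ω ∪ D`
is already reachable from `a` in the open graph of `ω` (an open path of `ω ∪ D` leaving the
`ω`-cluster of `a` would have to use the pair `s(v,x)` at a vertex of that cluster). [folklore] -/
theorem shorteningInA_reach_of_union {n : ℕ} (ω D : BondConfig (Fin n)) (v x a y : Fin n)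
    (hD : ∀ e : Sym2 (Fin n), e ∈ D → e = s(v, x))
    (hav : ¬ (openGraph ω).Reachable a v) (hax : ¬ (openGraph ω).Reachable a x)
    (h : (openGraph (ω ∪ D)).Reachable a y) : (openGraph ω).Reachable a y := by
  rw [SimpleGraph.reachable_iff_reflTransGen] at h
  induction h with
  | refl => exact SimpleGraph.Reachable.refl a
  | @tail p q _ hadj ih =>
    obtain ⟨hmem, hne⟩ := (openGraph_adj _ p q).1 hadj
    rcases hmem with hω | hDmem
    · exact ih.trans ((openGraph_adj ω p q).2 ⟨hω, hne⟩).reachable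
    · exfalso
      rcases Sym2.eq_iff.1 (hD _ hDmem) with ⟨hp, _⟩ | ⟨hp, _⟩
      · exact hav (hp ▸ ih)
      · exact hax (hp ▸ ih)

/-- For a finite measure, `μ S ≤ μ T` implies `μ (S ∖ T) ≤ μ (T ∖ S)` (subtract `μ (S ∩ T)`).
[folklore] -/
theorem shorteningInA_real_sdiff_le_sdiff {n : ℕ} (μ : Measure (BondConfig (Fin n)))
    [IsFiniteMeasure μ] (S T : Set (BondConfig (Fin n))) (hST : μ.real S ≤ μ.real T) :
    μ.real (S \ T) ≤ μ.real (T \ S) := by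
  have h1 : μ.real (S ∩ T) + μ.real (S \ T) = μ.real S :=
    measureReal_inter_add_sdiff (MeasurableSet.of_discrete (s := T))
  have h2 : μ.real (T ∩ S) + μ.real (T \ S) = μ.real T :=
    measureReal_inter_add_sdiff (MeasurableSet.of_discrete (s := S))
  rw [Set.inter_comm] at h2
  linarith

/-- **TTRL-lite variant V2397 by-product: the case `x ∈ A` of `stub_shorteningStep` (KN Conjecture 6), for every `n`.**  If the glued
partner `x` of the source `v` is itself a relay, `v ≠ x`, and `a₀` minimises `P_w(· ↔ b)` on `A`
(only `P_w(a₀ ↔ b) ≤ P_w(x ↔ b)` is used), then under `μ' = prodBernoulli (w[s(v,x) ↦ 1])`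
`μ'(v ↔ A) · μ'(a₀ ↔ b) ≤ μ'(v ↔ b)`; in fact `μ'(a₀ ↔ b) ≤ μ'(v ↔ b)`, by KN Lemma 3(ii) with
`Q = {a₀ ↮ v}` transported through the gluing push-forward.  Neither the induction hypothesis of
Lemma 13 nor `w s(v,x) = 0` nor `v ∉ A` is needed. [cite: KozmaNitzan2024, Conjecture 6, Lemma 3(ii)] -/
theorem stub_shorteningStep_var2397_inA : ∀ (n : ℕ) (w : Sym2 (Fin n) → unitInterval)
    (A : Finset (Fin n)) (b v x a₀ : Fin n), x ∈ A → v ≠ x →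
    (∀ a ∈ A, (prodBernoulli w).real (openConn a₀ b) ≤ (prodBernoulli w).real (openConn a b)) →
    (prodBernoulli (Function.update w s(v, x) 1)).real (⋃ a ∈ A, openConn v a) *
        (prodBernoulli (Function.update w s(v, x) 1)).real (openConn a₀ b) ≤
      (prodBernoulli (Function.update w s(v, x) 1)).real (openConn v b) := by
  intro n w A b v x a₀ hxA hvx hmin
  -- reduce to `μ'(a₀ ↔ b) ≤ μ'(v ↔ b)`
  have hY1 : (prodBernoulli (Function.update w s(v, x) 1)).real (⋃ a ∈ A, openConn v a) ≤ 1 :=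
    measureReal_le_one
  have hZ0 : 0 ≤ (prodBernoulli (Function.update w s(v, x) 1)).real (openConn a₀ b) :=
    measureReal_nonneg
  suffices hZX : (prodBernoulli (Function.update w s(v, x) 1)).real (openConn a₀ b) ≤
      (prodBernoulli (Function.update w s(v, x) 1)).real (openConn v b) by
    calc (prodBernoulli (Function.update w s(v, x) 1)).real (⋃ a ∈ A, openConn v a) *
          (prodBernoulli (Function.update w s(v, x) 1)).real (openConn a₀ b)
        ≤ 1 * (prodBernoulli (Function.update w s(v, x) 1)).real (openConn a₀ b) :=
          mul_le_mul_of_nonneg_right hY1 hZ0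
      _ = (prodBernoulli (Function.update w s(v, x) 1)).real (openConn a₀ b) := one_mul _
      _ ≤ (prodBernoulli (Function.update w s(v, x) 1)).real (openConn v b) := hZX
  -- the glued block `{v, x}` has exactly one non-loop pair, `s(v, x)`
  have hD : ∀ e : Sym2 (Fin n),
      ((∀ y ∈ e, y ∈ ({v, x} : Finset (Fin n))) ∧ ¬ e.IsDiag) ↔ e = s(v, x) := by
    intro e
    constructor
    · rintro ⟨hmem, hdiag⟩
      induction e using Sym2.ind with
      | h p q =>
        have hp := hmem p (Sym2.mem_mk_left p q)
        have hq := hmem q (Sym2.mem_mk_right p q)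
        have hpq : p ≠ q := fun h => hdiag (Sym2.mk_isDiag_iff.2 h)
        simp only [Finset.mem_insert, Finset.mem_singleton] at hp hq
        rcases hp with rfl | rfl <;> rcases hq with rfl | rfl
        · exact absurd rfl hpq
        · rfl
        · exact Sym2.eq_swap
        · exact absurd rfl hpq
    · rintro rfl
      refine ⟨fun y hy => ?_, fun hdiag => hvx (Sym2.mk_isDiag_iff.1 hdiag)⟩
      rcases Sym2.mem_iff.1 hy with rfl | rfl
      · exact Finset.mem_insert_self _ _
      · exact Finset.mem_insert_of_mem (Finset.mem_singleton_self _)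
  -- the updated weights are the glued weights of `stub_gluePushforward`
  have hw : Function.update w s(v, x) 1 =
      fun e => if (∀ y ∈ e, y ∈ ({v, x} : Finset (Fin n))) ∧ ¬ e.IsDiag then 1 else w e := by
    funext e
    by_cases he : e = s(v, x)
    · subst he
      rw [Function.update_self, if_pos ((hD _).2 rfl)]
    · rw [Function.update_of_ne he, if_neg (fun h => he ((hD e).1 h))]
  -- push-forward: `μ'(E) = μ_w (Φ⁻¹ E)` with `Φ ω = ω ∪ D`
  have hpush : ∀ E : Set (BondConfig (Fin n)),
      (prodBernoulli (Function.update w s(v, x) 1)).real E =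
        (prodBernoulli w).real
          {ω | (ω ∪ {e | (∀ y ∈ e, y ∈ ({v, x} : Finset (Fin n))) ∧ ¬ e.IsDiag}) ∈ E} := by
    intro E
    rw [hw]
    exact stub_gluePushforward n w {v, x} E
  have hDmem : ∀ e : Sym2 (Fin n),
      e ∈ ({e | (∀ y ∈ e, y ∈ ({v, x} : Finset (Fin n))) ∧ ¬ e.IsDiag} : Set (Sym2 (Fin n))) →
        e = s(v, x) := fun e he => (hD e).1 he
  have hvxD : s(v, x) ∈
      ({e | (∀ y ∈ e, y ∈ ({v, x} : Finset (Fin n))) ∧ ¬ e.IsDiag} : Set (Sym2 (Fin n))) :=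
    (hD _).2 rfl
  -- KN Lemma 3(ii) with the decreasing `C_{a₀}`-determined event `Q = {a₀ ↮ v}`
  have hL3 : (prodBernoulli w).real (openConn a₀ b ∩ (openConn a₀ v)ᶜ) ≤
      (prodBernoulli w).real (openConn x b ∩ (openConn a₀ v)ᶜ) := by
    have hQ : ∀ ω ω' : BondConfig (Fin n), ω' ∈ (openConn a₀ v : Set (BondConfig (Fin n)))ᶜ →
        openEdgeCluster ω a₀ ⊆ openEdgeCluster ω' a₀ →
          ω ∈ (openConn a₀ v : Set (BondConfig (Fin n)))ᶜ := by
      intro ω ω' hω' hsub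
      rw [Set.mem_compl_iff] at hω' ⊢
      intro hω
      rcases (reachable_iff_exists_mem_openEdgeCluster ω a₀ v).1 hω with h | ⟨e, he, hve⟩
      · exact hω' ((reachable_iff_exists_mem_openEdgeCluster ω' a₀ v).2 (Or.inl h))
      · exact hω' ((reachable_iff_exists_mem_openEdgeCluster ω' a₀ v).2 (Or.inr ⟨e, hsub he, hve⟩))
    have hmin' : (prodBernoulli w).real (openConn a₀ b) ≤
        (prodBernoulli w).real (openConn x b) + 0 := by
      rw [add_zero]; exact hmin x hxA
    have h := stub_knLemma3ii n w a₀ x b ((openConn a₀ v : Set (BondConfig (Fin n)))ᶜ) 0 hQ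
      le_rfl hmin'
    rwa [add_zero] at h
  -- the open graph only grows under `Φ`, and `v ∼ x` in `Φ ω`
  have hmonoG : ∀ ω : BondConfig (Fin n), openGraph ω ≤
      openGraph (ω ∪ {e | (∀ y ∈ e, y ∈ ({v, x} : Finset (Fin n))) ∧ ¬ e.IsDiag}) :=
    fun ω => openGraph_mono Set.subset_union_left
  have hadjΦ : ∀ ω : BondConfig (Fin n),
      (openGraph (ω ∪ {e | (∀ y ∈ e, y ∈ ({v, x} : Finset (Fin n))) ∧ ¬ e.IsDiag})).Adj v x :=
    fun ω => (openGraph_adj _ v x).2 ⟨Or.inr hvxD, hvx⟩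
  -- inclusion 1: `Φ⁻¹{a₀ ↔ b} ∖ Φ⁻¹{v ↔ b} ⊆ ({a₀ ↔ b} ∩ Q) ∖ ({x ↔ b} ∩ Q)`
  have hincl1 :
      ({ω | (ω ∪ {e | (∀ y ∈ e, y ∈ ({v, x} : Finset (Fin n))) ∧ ¬ e.IsDiag}) ∈
          (openConn a₀ b : Set (BondConfig (Fin n)))} \
        {ω | (ω ∪ {e | (∀ y ∈ e, y ∈ ({v, x} : Finset (Fin n))) ∧ ¬ e.IsDiag}) ∈
          (openConn v b : Set (BondConfig (Fin n)))}) ⊆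
      (openConn a₀ b ∩ (openConn a₀ v)ᶜ) \ (openConn x b ∩ (openConn a₀ v)ᶜ) := by
    rintro ω ⟨hA, hV⟩
    have hA' : (openGraph (ω ∪ {e | (∀ y ∈ e, y ∈ ({v, x} : Finset (Fin n))) ∧
        ¬ e.IsDiag})).Reachable a₀ b := hA
    have hV' : ¬ (openGraph (ω ∪ {e | (∀ y ∈ e, y ∈ ({v, x} : Finset (Fin n))) ∧
        ¬ e.IsDiag})).Reachable v b := hV
    have ha₀vΦ : ¬ (openGraph (ω ∪ {e | (∀ y ∈ e, y ∈ ({v, x} : Finset (Fin n))) ∧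
        ¬ e.IsDiag})).Reachable a₀ v := fun h => hV' (h.symm.trans hA')
    have ha₀v : ¬ (openGraph ω).Reachable a₀ v := fun h => ha₀vΦ (h.mono (hmonoG ω))
    have ha₀x : ¬ (openGraph ω).Reachable a₀ x :=
      fun h => ha₀vΦ ((h.mono (hmonoG ω)).trans (hadjΦ ω).symm.reachable)
    have ha₀b : (openGraph ω).Reachable a₀ b :=
      shorteningInA_reach_of_union ω _ v x a₀ b hDmem ha₀v ha₀x hA'
    refine ⟨⟨ha₀b, ?_⟩, ?_⟩
    · rw [Set.mem_compl_iff]; exact ha₀v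
    · rintro ⟨hxb, _⟩
      have hxb' : (openGraph ω).Reachable x b := hxb
      exact hV' ((hadjΦ ω).reachable.trans (hxb'.mono (hmonoG ω)))
  -- inclusion 2: `({x ↔ b} ∩ Q) ∖ ({a₀ ↔ b} ∩ Q) ⊆ Φ⁻¹{v ↔ b} ∖ Φ⁻¹{a₀ ↔ b}`
  have hincl2 :
      (openConn x b ∩ (openConn a₀ v)ᶜ) \ (openConn a₀ b ∩ (openConn a₀ v)ᶜ) ⊆
      ({ω | (ω ∪ {e | (∀ y ∈ e, y ∈ ({v, x} : Finset (Fin n))) ∧ ¬ e.IsDiag}) ∈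
          (openConn v b : Set (BondConfig (Fin n)))} \
        {ω | (ω ∪ {e | (∀ y ∈ e, y ∈ ({v, x} : Finset (Fin n))) ∧ ¬ e.IsDiag}) ∈
          (openConn a₀ b : Set (BondConfig (Fin n)))}) := by
    rintro ω ⟨⟨hxb, ha₀v⟩, hnot⟩
    have hxb' : (openGraph ω).Reachable x b := hxb
    rw [Set.mem_compl_iff] at ha₀v
    have ha₀v' : ¬ (openGraph ω).Reachable a₀ v := ha₀v
    have ha₀b : ¬ (openGraph ω).Reachable a₀ b := by
      intro h
      refine hnot ⟨h, ?_⟩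
      rw [Set.mem_compl_iff]; exact ha₀v
    have ha₀x : ¬ (openGraph ω).Reachable a₀ x := fun h => ha₀b (h.trans hxb')
    refine ⟨?_, ?_⟩
    · show (openGraph (ω ∪ {e | (∀ y ∈ e, y ∈ ({v, x} : Finset (Fin n))) ∧
          ¬ e.IsDiag})).Reachable v b
      exact (hadjΦ ω).reachable.trans (hxb'.mono (hmonoG ω))
    · intro hAΦ
      have hAΦ' : (openGraph (ω ∪ {e | (∀ y ∈ e, y ∈ ({v, x} : Finset (Fin n))) ∧
          ¬ e.IsDiag})).Reachable a₀ b := hAΦ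
      exact ha₀b (shorteningInA_reach_of_union ω _ v x a₀ b hDmem ha₀v' ha₀x hAΦ')
  -- assemble: `μ_w(PA ∖ PV) ≤ μ_w(Ea ∖ Ex) ≤ μ_w(Ex ∖ Ea) ≤ μ_w(PV ∖ PA)`
  rw [hpush (openConn a₀ b), hpush (openConn v b)]
  have hchain := calc
    (prodBernoulli w).real
        ({ω | (ω ∪ {e | (∀ y ∈ e, y ∈ ({v, x} : Finset (Fin n))) ∧ ¬ e.IsDiag}) ∈
            (openConn a₀ b : Set (BondConfig (Fin n)))} \
          {ω | (ω ∪ {e | (∀ y ∈ e, y ∈ ({v, x} : Finset (Fin n))) ∧ ¬ e.IsDiag}) ∈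
            (openConn v b : Set (BondConfig (Fin n)))})
      ≤ (prodBernoulli w).real
          ((openConn a₀ b ∩ (openConn a₀ v)ᶜ) \ (openConn x b ∩ (openConn a₀ v)ᶜ)) :=
        measureReal_mono hincl1
    _ ≤ (prodBernoulli w).real
          ((openConn x b ∩ (openConn a₀ v)ᶜ) \ (openConn a₀ b ∩ (openConn a₀ v)ᶜ)) :=
        shorteningInA_real_sdiff_le_sdiff _ _ _ hL3
    _ ≤ (prodBernoulli w).real
        ({ω | (ω ∪ {e | (∀ y ∈ e, y ∈ ({v, x} : Finset (Fin n))) ∧ ¬ e.IsDiag}) ∈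
            (openConn v b : Set (BondConfig (Fin n)))} \
          {ω | (ω ∪ {e | (∀ y ∈ e, y ∈ ({v, x} : Finset (Fin n))) ∧ ¬ e.IsDiag}) ∈
            (openConn a₀ b : Set (BondConfig (Fin n)))}) :=
        measureReal_mono hincl2
  have h1 := measureReal_inter_add_sdiff (μ := prodBernoulli w)
    (s := {ω | (ω ∪ {e | (∀ y ∈ e, y ∈ ({v, x} : Finset (Fin n))) ∧ ¬ e.IsDiag}) ∈
            (openConn a₀ b : Set (BondConfig (Fin n)))})
    (MeasurableSet.of_discrete
      (s := {ω | (ω ∪ {e | (∀ y ∈ e, y ∈ ({v, x} : Finset (Fin n))) ∧ ¬ e.IsDiag}) ∈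
            (openConn v b : Set (BondConfig (Fin n)))}))
  have h2 := measureReal_inter_add_sdiff (μ := prodBernoulli w)
    (s := {ω | (ω ∪ {e | (∀ y ∈ e, y ∈ ({v, x} : Finset (Fin n))) ∧ ¬ e.IsDiag}) ∈
            (openConn v b : Set (BondConfig (Fin n)))})
    (MeasurableSet.of_discrete
      (s := {ω | (ω ∪ {e | (∀ y ∈ e, y ∈ ({v, x} : Finset (Fin n))) ∧ ¬ e.IsDiag}) ∈
            (openConn a₀ b : Set (BondConfig (Fin n)))}))
  rw [Set.inter_comm] at h2
  linarith

end Summit.CriticalPhenomena.PercolationContinuityZ3.Theorems
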